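import Summits.QuantumFields.YangMills.Theorems.LuscherReductionTwistedTraceScalingBOTransport
import Summits.QuantumFields.YangMills.Theorems.LuscherReductionTwistedTraceScalingBTCorePair
import HarnessLib

/-!
# THE TRANSPORT EXPONENT IS SMALL ON THE CORES: `|offX + diagX| ≤ coreEta + coreEps1 + coreEps2` pointwise, and the transported fibre transfer
# (lane A of S-BASE, crux `TwistedTraceScaling` stmt-QuantumFields-20203, C4-CORE, the (OD) pen, step (C2) of `pub/ym-fleet/ym-luscher-20007-p1/COARSE-DESIGN.md` §27.5)

`…BOTransport.fpFibreTransfer_two_sided` transports the colour-localised one-sided fibre transfer to the central fibre `u = u' = 1` as soon as the exponent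
`offX β u' u v' v g + diagX β u' v' v g` is bounded on the supports.  This file supplies the POINTWISE bound with the (B-T) envelopes of `…BTCorePair` —
no Haar average over the colour conjugates is taken (the first-order colour term `diagX1(slowLin u')` is simply bounded by `coreEps1`):
* ★★ `abs_transportExponent_le` — for the output slow point `u'` in the window `‖u'_k − 1‖ ≤ δ ≤ 1/2`, the input slow point `u` at distance `‖u'_k − u_k‖ ≤ α ≤ 1`, both one-site
  actions `≤ σ/L³` (`σ < 2`), output AND input fibre data in the core `|v_{e,c}| ≤ T ≤ 1/30`, `‖v̂‖ ≤ R`, and a based gauge field in the core `‖g_x − 1‖ ≤ T`, `‖Σ_x g⃗_x‖ ≤ Γ`: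
  `|offX β u' u v' v g + diagX β u' v' v g| ≤ coreEta L β δ α T R Γ σ + coreEps1 L β δ T R + coreEps2 L β δ T R σ`
  (`abs_offX_le` + `abs_diagX1_le` at `c = slowLin u'`, `|c| ≤ 2δ` + `abs_diagX_sub_diagX1_le`);
* ★★★ `fpFibreTransfer_two_sided_core` — hence, for `Ω ≥ 0` supported in the fibre core and `W ≥ 0` supported in the gauge core, the sandwich
  `e^{−η}ρT₁ ≤ fpFibreTransfer β Ω W (oT u' v') u ≤ e^{η}ρT₁` with `η = coreEta + coreEps1 + coreEps2`, `ρ = K₁(u',u)/K₁(1,1)`, `T₁` the central transfer.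
On schedule B (`T = β^{-1/2}ℓ`, `βR² ≤ ℓ²`, `δ = MKβ^{-s}`, near pairs `α ≤ β^{-1/2}ℓ²`, `Γ ≤ |Site|·T`, `σ ≤ 12L³δ²`) the envelopes of `…BTProfileEnvelopes` give `η = O(β^{-s}ℓ⁴ + β^{-1/2}ℓ⁸)`,
`o(β^{-1/6})` iff `s > 1/6`.
HONEST FRAMING: elementary inequalities for a stub of a child of the CONDITIONAL route R2b1; (B-OD), (B-ST) OPEN; C4-CORE OPEN; not infinite volume, not a gap, not Clay.
-/

set_option autoImplicit false

noncomputable section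

open MeasureTheory Filter Topology Real
open scoped BigOperators
open Literature.MathematicalPhysics.QuantumFieldTheory
open Literature.MathematicalPhysics.QuantumLattice

namespace Summit.QuantumFields.YangMills.Theorems.FemtoTransferGap.TwoLattice.ConstTube

open Summit.QuantumFields.YangMills.Theorems.FemtoTransferGap
open Summit.QuantumFields.YangMills.Theorems.FemtoTransferGap.TwoLattice
open Summit.QuantumFields.YangMills.Theorems.FemtoTransferGap.TwoLattice.Avg
open Summit.QuantumFields.YangMills.Theorems.FemtoTransferGap.TwoLattice.Stiff
open Summit.QuantumFields.YangMills.Theorems.FemtoTransferGap.TwoLattice.Cov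
open Summit.QuantumFields.YangMills.Theorems.FemtoTransferGap.TwoLattice.Toron

variable {L : ℕ} [NeZero L]

/-! ## §1 ★★ The pointwise envelope of the transport exponent -/

/-- ★★ **POINTWISE ENVELOPE OF THE TRANSPORT EXPONENT**: `|offX β u' u v' v g + diagX β u' v' v g| ≤ coreEta + coreEps1 + coreEps2` on the cores (see the module docstring for
the hypotheses). [cite: Luscher1983, §3] -/
theorem abs_transportExponent_le {β : ℝ} (hβ : 0 ≤ β) (u' u : GaugeConfig 3 1 SU2) {v' v : Edge 3 L → Fin 3 → ℝ} (hv' : v' ∈ capBalancedSet L)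
    (hv : v ∈ capBalancedSet L) {g : Site 3 L → SU2} {δ α T R Γ σ : ℝ}
    (hδ : ∀ k : Fin 3, ‖su2Quat (u' (0, k)) - 1‖ ≤ δ) (hδ1 : δ ≤ 1 / 2) (hα : ∀ k : Fin 3, ‖su2Quat (u' (0, k)) - su2Quat (u (0, k))‖ ≤ α) (hα1 : α ≤ 1)
    (hT : T ≤ 1 / 30) (hσ : σ < 2) (hS' : (L : ℝ) ^ 3 * wilsonAction su2Rep u' ≤ σ) (hS : (L : ℝ) ^ 3 * wilsonAction su2Rep u ≤ σ)
    (hv'T : ∀ (e : Edge 3 L) (c : Fin 3), |v' e c| ≤ T) (hx' : ‖linkEmbed L v'‖ ≤ R) (hvT : ∀ (e : Edge 3 L) (c : Fin 3), |v e c| ≤ T) (hx : ‖linkEmbed L v‖ ≤ R)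
    (hgT : ∀ x, ‖su2Quat (g x) - 1‖ ≤ T) (hΓ : ‖∑ x, vecPart (g x)‖ ≤ Γ) :
    |offX L β u' u v' v g + diagX L β u' v' v g| ≤ coreEta L β δ α T R Γ σ + coreEps1 L β δ T R + coreEps2 L β δ T R σ := by
  -- sizes
  have hδ0 : 0 ≤ δ := (norm_nonneg _).trans (hδ 0)
  have hδ1' : δ ≤ 1 := by linarith
  have hα0 : 0 ≤ α := (norm_nonneg _).trans (hα 0)
  have hT0 : 0 ≤ T := (abs_nonneg _).trans (hvT ((0 : Site 3 L), (0 : Fin 3)) 0)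
  have hσ0 : 0 ≤ σ := le_trans (mul_nonneg (by positivity) (wilsonAction_su2_nonneg u)) hS
  have hR0 : 0 ≤ R := (norm_nonneg _).trans hx
  have hE0 : (0 : ℝ) ≤ Fintype.card (Edge 3 L) := Nat.cast_nonneg _
  have hN0 : (0 : ℝ) ≤ Fintype.card (Plaquette 3 L × Fin 3) := Nat.cast_nonneg _
  -- slow data in the shapes of the engines
  have ha : ∀ (k : Fin 3) (c : Fin 3), |vecPart (u' (0, k) * (u (0, k))⁻¹) c| ≤ α := fun k c => by
    refine (abs_vecPart_le_norm_sub_one _ c).trans ?_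
    rw [norm_su2Quat_mul_inv_sub_one]; exact hα k
  have hw0 : ∀ k : Fin 3, 0 ≤ scalarPart (u' (0, k) * (u (0, k))⁻¹) := fun k =>
    scalarPart_mul_inv_nonneg (by nlinarith [pow_le_pow_left₀ (norm_nonneg _) ((hα k).trans hα1) 2, norm_nonneg (su2Quat (u' (0, k)) - su2Quat (u (0, k)))])
  have hun : ∀ k : Fin 3, ‖vecPart (u' (0, k))‖ ≤ δ := fun k => (norm_vecPart_le_norm_sub_one _).trans (hδ k)
  have hua : ∀ (k : Fin 3) (a : Fin 3), |vecPart (u' (0, k)) a| ≤ δ := fun k a => (abs_vecPart_le_norm_sub_one _ a).trans (hδ k)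
  have hu2 : ∀ k : Fin 3, ∑ a, vecPart (u' (0, k)) a ^ 2 ≤ δ ^ 2 := fun k =>
    (sum_sq_vecPart_le_norm_sub_one_sq _).trans (pow_le_pow_left₀ (norm_nonneg _) (hδ k) 2)
  -- gauge data
  have hg0 : ∀ x, 0 ≤ scalarPart (g x) := fun x => scalarPart_nonneg_of_norm_sub_one_le ((hgT x).trans (by linarith))
  have hgt : ∀ x, ∑ c, vecPart (g x) c ^ 2 ≤ T ^ 2 := fun x => (sum_sq_vecPart_le_norm_sub_one_sq _).trans (pow_le_pow_left₀ (norm_nonneg _) (hgT x) 2)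
  have hgn : ∀ x, ‖vecPart (g x)‖ ≤ T := fun x => (norm_vecPart_le_norm_sub_one _).trans (hgT x)
  -- per-edge kinetic product `‖g⃗_y‖·‖M⃗_e‖ ≤ T·(12T)` (output fibre datum `v'` first, input `v` second)
  have hsq : ∀ w : Fin 3 → ℝ, (∀ c, |w c| ≤ T) → ∑ a, w a ^ 2 ≤ 1 := fun w hw => by
    rw [Fin.sum_univ_three]
    have b0 := pow_le_pow_left₀ (abs_nonneg _) (hw 0) 2
    have b1 := pow_le_pow_left₀ (abs_nonneg _) (hw 1) 2
    have b2 := pow_le_pow_left₀ (abs_nonneg _) (hw 2) 2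
    rw [sq_abs] at b0 b1 b2
    nlinarith
  have hM : ∀ e : Edge 3 L, ‖vecPart (g (e.1.shift e.2))‖ * ‖vecPart (linkM L v' v g e)‖ ≤ T * (12 * T) := by
    intro e
    have hv'e : ‖v' e‖ ≤ T := (pi_norm_le_iff_of_nonneg hT0).mpr fun c => by rw [Real.norm_eq_abs]; exact hv'T e c
    have hve : ‖v e‖ ≤ T := (pi_norm_le_iff_of_nonneg hT0).mpr fun c => by rw [Real.norm_eq_abs]; exact hvT e c
    have hMe := norm_vecPart_linkM_le (hsq (v' e) (hv'T e)) (hsq (v e) (hvT e)) (g e.1)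
    have hg1 : ‖vecPart (g e.1)‖ ≤ T := hgn e.1
    have hM' : ‖vecPart (linkM L v' v g e)‖ ≤ 12 * T := by unfold linkM; linarith
    exact mul_le_mul (hgn _) hM' (norm_nonneg _) hT0
  have hx2 : ‖linkEmbed L v‖ ^ 2 ≤ R ^ 2 := pow_le_pow_left₀ (norm_nonneg _) hx 2
  have hx'2 : ‖linkEmbed L v'‖ ^ 2 ≤ R ^ 2 := pow_le_pow_left₀ (norm_nonneg _) hx' 2
  -- (i) the off-diagonal exponent
  have hoff : |offX L β u' u v' v g| ≤ coreEta L β δ α T R Γ σ := by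
    have h := abs_offX_le hβ u' u hv' hv hT hσ hS' hS hv'T hvT hg0 hgt hΓ hα1 ha hw0 hun
    unfold coreEta
    have k1 := mul_le_mul_of_nonneg_left hx2 (mul_nonneg (mul_nonneg (by norm_num : (0 : ℝ) ≤ 100) hσ0) hN0)
    have k2 := mul_le_mul_of_nonneg_left hx2 (mul_nonneg (mul_nonneg (by norm_num : (0 : ℝ) ≤ 10080) hα0) hN0)
    have hβ2 : 0 ≤ β / 2 := by linarith
    nlinarith [mul_le_mul_of_nonneg_left (add_le_add k1 k2) hβ2]
  -- (ii) the linear part of the diagonal exponent at `c = slowLin u'`, `|c| ≤ 2δ`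
  have hlin : |diagX1 L β (slowLin u') v' v g| ≤ coreEps1 L β δ T R := by
    have hc : ∀ k a, |slowLin u' k a| ≤ 2 * δ := fun k a => abs_slowLin_le u' hua k a
    have h := abs_diagX1_le (L := L) hβ (c := slowLin u') (α := 2 * δ) hc v' v g
    have hck : ∀ e : Edge 3 L, ‖slowLin u' e.2‖ ≤ 2 * δ := fun e =>
      (pi_norm_le_iff_of_nonneg (by positivity)).mpr fun a => by rw [Real.norm_eq_abs]; exact hc e.2 a
    have hs : ∑ e : Edge 3 L, ‖slowLin u' e.2‖ * ‖vecPart (g (e.1.shift e.2))‖ * ‖vecPart (linkM L v' v g e)‖ ≤ (Fintype.card (Edge 3 L) : ℝ) * ((2 * δ) * T * (12 * T)) := by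
      refine (Finset.sum_le_sum fun e _ => ?_).trans (by rw [Finset.sum_const, Finset.card_univ, nsmul_eq_mul])
      have h1 := hM e
      have h2 := hck e
      calc ‖slowLin u' e.2‖ * ‖vecPart (g (e.1.shift e.2))‖ * ‖vecPart (linkM L v' v g e)‖
          = ‖slowLin u' e.2‖ * (‖vecPart (g (e.1.shift e.2))‖ * ‖vecPart (linkM L v' v g e)‖) := by ring
        _ ≤ (2 * δ) * (T * (12 * T)) := mul_le_mul h2 h1 (mul_nonneg (norm_nonneg _) (norm_nonneg _)) (by positivity)
        _ = (2 * δ) * T * (12 * T) := by ring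
    unfold coreEps1
    have h2 := add_le_add hx'2 hx2
    nlinarith [mul_le_mul_of_nonneg_left hs (by positivity : (0 : ℝ) ≤ β * 12),
      mul_le_mul_of_nonneg_left h2 (by positivity : (0 : ℝ) ≤ β * (40 * (2 * δ) * (Fintype.card (Plaquette 3 L × Fin 3) : ℝ)))]
  -- (iii) the second-order remainder of the diagonal exponent
  have hrem : |diagX L β u' v' v g - diagX1 L β (slowLin u') v' v g| ≤ coreEps2 L β δ T R σ := by
    have h := abs_diagX_sub_diagX1_le hβ u' hv' hv (τ := T) hT hσ hS' hv'T hvT hδ1' hua g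
    have hs : ∑ e : Edge 3 L, ‖vecPart (u' (0, e.2))‖ ^ 2 * ‖vecPart (g (e.1.shift e.2))‖ * ‖vecPart (linkM L v' v g e)‖ ≤
        (Fintype.card (Edge 3 L) : ℝ) * (δ ^ 2 * T * (12 * T)) := by
      refine (Finset.sum_le_sum fun e _ => ?_).trans (by rw [Finset.sum_const, Finset.card_univ, nsmul_eq_mul])
      have h1 := hM e
      have h2 : ‖vecPart (u' (0, e.2))‖ ^ 2 ≤ δ ^ 2 := pow_le_pow_left₀ (norm_nonneg _) (hun e.2) 2
      calc ‖vecPart (u' (0, e.2))‖ ^ 2 * ‖vecPart (g (e.1.shift e.2))‖ * ‖vecPart (linkM L v' v g e)‖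
          = ‖vecPart (u' (0, e.2))‖ ^ 2 * (‖vecPart (g (e.1.shift e.2))‖ * ‖vecPart (linkM L v' v g e)‖) := by ring
        _ ≤ δ ^ 2 * (T * (12 * T)) := mul_le_mul h2 h1 (mul_nonneg (norm_nonneg _) (norm_nonneg _)) (by positivity)
        _ = δ ^ 2 * T * (12 * T) := by ring
    have hcov : ∀ w : Edge 3 L → Fin 3 → ℝ, ‖linkEmbed L w‖ ≤ R →
        (σ / 2 * ‖covCurl (constLift L u') (linkEmbed L w)‖ ^ 2 + stepActionErr (L := L) T σ) + stepActionErr (L := L) T 0 +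
          145000000 * (Fintype.card (Plaquette 3 L × Fin 3) : ℝ) * δ ^ 2 * ‖linkEmbed L w‖ ^ 2 ≤
        (σ / 2 * (10 * Real.sqrt (Fintype.card (Plaquette 3 L × Fin 3)) * R) ^ 2 + stepActionErr (L := L) T σ) + stepActionErr (L := L) T 0 +
          145000000 * (Fintype.card (Plaquette 3 L × Fin 3) : ℝ) * δ ^ 2 * R ^ 2 := by
      intro w hw
      have h1 : ‖covCurl (constLift L u') (linkEmbed L w)‖ ^ 2 ≤ (10 * Real.sqrt (Fintype.card (Plaquette 3 L × Fin 3)) * R) ^ 2 := by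
        have hc := norm_covCurl_le_op (constLift L u') (linkEmbed L w)
        exact pow_le_pow_left₀ (norm_nonneg _) (hc.trans (mul_le_mul_of_nonneg_left hw (by positivity))) 2
      have h2 : ‖linkEmbed L w‖ ^ 2 ≤ R ^ 2 := pow_le_pow_left₀ (norm_nonneg _) hw 2
      linarith [mul_le_mul_of_nonneg_left h1 (by positivity : (0 : ℝ) ≤ σ / 2),
        mul_le_mul_of_nonneg_left h2 (by positivity : (0 : ℝ) ≤ 145000000 * (Fintype.card (Plaquette 3 L × Fin 3) : ℝ) * δ ^ 2)]
    have h1 := hcov v' hx'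
    have h2 := hcov v hx
    unfold coreEps2
    linarith [mul_le_mul_of_nonneg_left hs (by positivity : (0 : ℝ) ≤ β * 48), mul_le_mul_of_nonneg_left h1 (by positivity : (0 : ℝ) ≤ β / 2),
      mul_le_mul_of_nonneg_left h2 (by positivity : (0 : ℝ) ≤ β / 2)]
  -- combine
  have hdiag : |diagX L β u' v' v g| ≤ coreEps1 L β δ T R + coreEps2 L β δ T R σ := by
    have e : diagX L β u' v' v g = diagX1 L β (slowLin u') v' v g + (diagX L β u' v' v g - diagX1 L β (slowLin u') v' v g) := by ring
    rw [e]
    exact (abs_add_le _ _).trans (add_le_add hlin hrem)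
  calc |offX L β u' u v' v g + diagX L β u' v' v g| ≤ |offX L β u' u v' v g| + |diagX L β u' v' v g| := abs_add_le _ _
    _ ≤ coreEta L β δ α T R Γ σ + (coreEps1 L β δ T R + coreEps2 L β δ T R σ) := add_le_add hoff hdiag
    _ = _ := by ring

/-! ## §2 ★★★ The transported fibre transfer on the cores -/

/-- ★★★ **THE FIBRE TRANSFER, TRANSPORTED TO THE CENTRAL FIBRE, ON THE CORES.**  With `Ω ≥ 0` supported in the fibre core (`|v_{e,c}| ≤ T`, `‖v̂‖ ≤ R` on `supp Ω`), `W ≥ 0`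
supported in the gauge core (`‖g_x − 1‖ ≤ T`, `‖Σ g⃗‖ ≤ Γ` on `supp W`), an output point `oT u' v'` with `u'` in the `δ`-window and `v'` in the fibre core, and an input slow
point `u` at distance `≤ α` from `u'` (one-site actions `≤ σ/L³`):  `e^{−η}·ρ·T₁ ≤ fpFibreTransfer β Ω W (oT u' v') u ≤ e^{η}·ρ·T₁` with
`η = coreEta + coreEps1 + coreEps2`, `ρ = K₁^{(L³β)}(u',u)/K₁^{(L³β)}(1,1)`, `T₁ = fpFibreTransfer β Ω W (oT 1 v') 1`. [cite: Luscher1983, §3] -/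
theorem fpFibreTransfer_two_sided_core {β : ℝ} (hβ : 0 ≤ β) {Ω : LinkSpace L → ℝ} (hΩm : Measurable Ω) {CΩ : ℝ} (hCΩ : ∀ x, |Ω x| ≤ CΩ) (hΩ0 : ∀ x, 0 ≤ Ω x)
    {W : (Site 3 L → SU2) → ℝ} (hW : Measurable W) {CW : ℝ} (hCW : ∀ g, |W g| ≤ CW) (hW0 : ∀ g, 0 ≤ W g)
    (u' u : GaugeConfig 3 1 SU2) {v' : Edge 3 L → Fin 3 → ℝ} (hv' : v' ∈ capBalancedSet L) {δ α T R Γ σ : ℝ}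
    (hδ : ∀ k : Fin 3, ‖su2Quat (u' (0, k)) - 1‖ ≤ δ) (hδ1 : δ ≤ 1 / 2) (hα : ∀ k : Fin 3, ‖su2Quat (u' (0, k)) - su2Quat (u (0, k))‖ ≤ α) (hα1 : α ≤ 1)
    (hT : T ≤ 1 / 30) (hσ : σ < 2) (hS' : (L : ℝ) ^ 3 * wilsonAction su2Rep u' ≤ σ) (hS : (L : ℝ) ^ 3 * wilsonAction su2Rep u ≤ σ)
    (hv'T : ∀ (e : Edge 3 L) (c : Fin 3), |v' e c| ≤ T) (hx' : ‖linkEmbed L v'‖ ≤ R)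
    (hΩt : ∀ v : Edge 3 L → Fin 3 → ℝ, Ω (linkEmbed L v) ≠ 0 → v ∈ capBalancedSet L ∧ (∀ (e : Edge 3 L) (c : Fin 3), |v e c| ≤ T) ∧ ‖linkEmbed L v‖ ≤ R)
    (hWc : ∀ g : Site 3 L → SU2, W g ≠ 0 → (∀ x, ‖su2Quat (g x) - 1‖ ≤ T) ∧ ‖∑ x, vecPart (g x)‖ ≤ Γ) :
    Real.exp (-(coreEta L β δ α T R Γ σ + coreEps1 L β δ T R + coreEps2 L β δ T R σ)) *
        (transferKernel su2Rep ((L : ℝ) ^ 3 * β) u' u / transferKernel su2Rep ((L : ℝ) ^ 3 * β) (1 : GaugeConfig 3 1 SU2) 1) *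
        fpFibreTransfer L β Ω W (orthoTube L 1 v') 1 ≤ fpFibreTransfer L β Ω W (orthoTube L u' v') u ∧
      fpFibreTransfer L β Ω W (orthoTube L u' v') u ≤
        Real.exp (coreEta L β δ α T R Γ σ + coreEps1 L β δ T R + coreEps2 L β δ T R σ) *
          (transferKernel su2Rep ((L : ℝ) ^ 3 * β) u' u / transferKernel su2Rep ((L : ℝ) ^ 3 * β) (1 : GaugeConfig 3 1 SU2) 1) *
          fpFibreTransfer L β Ω W (orthoTube L 1 v') 1 :=
  fpFibreTransfer_two_sided β hΩm hCΩ hΩ0 hW hCW hW0 u u' v' fun v g hΩv hWg => by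
    obtain ⟨hv, hvT, hx⟩ := hΩt v hΩv
    obtain ⟨hgT, hΓ⟩ := hWc g hWg
    exact abs_transportExponent_le hβ u' u hv' hv hδ hδ1 hα hα1 hT hσ hS' hS hv'T hx' hvT hx hgT hΓ

end Summit.QuantumFields.YangMills.Theorems.FemtoTransferGap.TwoLattice.ConstTube

end
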